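import Summits.QuantumFields.YangMills.Theorems.IR.EsPolymerPeierlsTailK

/-!
# Crux `IR` (item stmt-QuantumFields-19354) — line «es-polymer-decoupling», reshaped engine, inputs (a)+(b) combined:
COVARIANCES OF RADIUS-`k` BLOCK OBSERVABLES = GAS COVARIANCE + PEIERLS-SMALL ERROR

Helper module for item `stmt-QuantumFields-19354` (`--supports … --as helper`; it closes nothing; lead prover
ym-ir-line-mxc-p1 g2).  For abstract representation data with clauses (P), (I)_k, (D)_k (as delivered by `DPRk` of
`Theorems/IR/EsPolymerDefsK.lean`) and `(13⁴+1)² √p ≤ 1/2`: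
`|Cov_μ(A,B) − Cov_gas(Φ_A ∘ nearFamily_A, Φ_B ∘ nearFamily_B)| ≤ 4 C_A C_B (2k+3)⁴ (√p)^{(cellDist c_A c_B − (2k+2))/6 + 2}`
(`abs_cov_sub_gasCov_le_pow`).  What remains for the engine `PolymerEngineK` is (c) the exponential mixing of the hard-core
cell gas for near-family functionals (Kotecký–Preiss cluster expansion) and the species ↦ block bookkeeping at mesh
`⌈ℓ/a β⌉`; neither is claimed here.

HONEST FRAMING: bookkeeping for an OPEN engine stub of a CONDITIONAL rung line; no clustering, no polymer representation at
weak coupling and no mass gap is proved here. -/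

set_option autoImplicit false

noncomputable section

open MeasureTheory Finset Function
open Literature.MathematicalPhysics.QuantumFieldTheory

namespace Summit.QuantumFields.YangMills.Cruxes.IR.EsPolymer

section CovBound

variable {G : Type} [MeasurableSpace G] {N q : ℕ}
  (ν : Finset (Finset (Cell q)) → Measure (GaugeConfig 4 N G)) (μ : Measure (GaugeConfig 4 N G))
  [IsProbabilityMeasure μ] (hsum : Finset.univ.sum ν = μ) (hν0 : ∀ Γ, ¬ Compatible Γ → ν Γ = 0)

include hsum hν0

/-- **Block covariances = gas covariance + Peierls-small error** (clauses (P), (I)_k, (D)_k; `(13⁴+1)² √p ≤ 1/2`). -/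
theorem abs_cov_sub_gasCov_le_pow [Nonempty G] [NeZero q] {A B : GaugeConfig 4 N G → ℝ} (hAm : Measurable A)
    (hBm : Measurable B) {CA CB : ℝ} (hA : ∀ U, |A U| ≤ CA) (hB : ∀ U, |B U| ≤ CB) (k : ℕ) (cA cB : Cell q)
    (act : Finset (Cell q) → ℝ) (hact : ∀ γ, 0 ≤ act γ) {Z p : ℝ}
    (hmass : ∀ Γ, Compatible Γ → (ν Γ Set.univ).toReal = Z⁻¹ * ∏ γ ∈ Γ, act γ) (hp : 0 ≤ p)
    (hactp : ∀ γ, act γ ≤ p ^ γ.card) (hsmall : ((13 : ℝ) ^ 4 + 1) ^ 2 * Real.sqrt p ≤ 1 / 2)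
    (hI : ∀ Γ, Compatible Γ → Disjoint (nearFamily Γ cA k) (nearFamily Γ cB k) →
      (ν Γ Set.univ).toReal * ∫ U, A U * B U ∂(ν Γ) = (∫ U, A U ∂(ν Γ)) * (∫ U, B U ∂(ν Γ)))
    (ΦA ΦB : Finset (Finset (Cell q)) → ℝ)
    (hΦA : ∀ Γ, Compatible Γ → ∫ U, A U ∂(ν Γ) = (ν Γ Set.univ).toReal * ΦA (nearFamily Γ cA k))
    (hΦB : ∀ Γ, Compatible Γ → ∫ U, B U ∂(ν Γ) = (ν Γ Set.univ).toReal * ΦB (nearFamily Γ cB k)) :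
    |((∫ U, A U * B U ∂μ) - (∫ U, A U ∂μ) * (∫ U, B U ∂μ)) -
        ((∑ Γ, (ν Γ Set.univ).toReal * (ΦA (nearFamily Γ cA k) * ΦB (nearFamily Γ cB k))) -
          (∑ Γ, (ν Γ Set.univ).toReal * ΦA (nearFamily Γ cA k)) *
            (∑ Γ, (ν Γ Set.univ).toReal * ΦB (nearFamily Γ cB k)))| ≤
      4 * CA * CB * ((2 * k + 3 : ℕ) : ℝ) ^ 4 * Real.sqrt p ^ ((cellDist cA cB - (2 * k + 2)) / 6 + 2) := by
  have hCA : 0 ≤ CA := (abs_nonneg _).trans (hA fun _ => Classical.arbitrary G)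
  have hCB : 0 ≤ CB := (abs_nonneg _).trans (hB fun _ => Classical.arbitrary G)
  refine (abs_cov_sub_gasCov_le_nearFamily ν μ hsum hν0 hAm hBm hA hB k cA cB hI ΦA ΦB hΦA hΦB).trans ?_
  have htail := sum_mass_not_disjoint_nearFamily_le_pow ν μ hsum hν0 act hact hmass hp hactp hsmall k cA cB
  calc 2 * CA * CB * _ ≤ 2 * CA * CB * (2 * ((2 * k + 3 : ℕ) : ℝ) ^ 4 *
        Real.sqrt p ^ ((cellDist cA cB - (2 * k + 2)) / 6 + 2)) :=
        mul_le_mul_of_nonneg_left htail (by positivity)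
    _ = _ := by ring

end CovBound

end Summit.QuantumFields.YangMills.Cruxes.IR.EsPolymer

end
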